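import Summits.Ventures.PercRepro.Night2T3Corank

/-!
# PercRepro — the type-`3` balance at corank `4` (night-2, NIGHT-2-t3.md §7 (5), the case `d = 4` for every `q`)

Write `C_j` for the rank-`q` subsets `S` of `G` with `|G ∖ S| = j`.  Shrinking the complement gives the standard
up-degree bound `(j + 1)·#C_{j+1} ≤ (|G| − j)·#C_j` (`succ_mul_card_le`): every pair `(S, x)` with `S ∈ C_{j+1}`,
`x ∈ G ∖ S` maps injectively to the pair `(S ∪ x, x)` with `S ∪ x ∈ C_j`.  At corank `4` the size form of the balance
has the terms `2j − 7` (`j = 0..4`), the sets with `j ≤ 2` are demand-free, and `3·#C_3 ≤ (q + 2)·#C_2` pays the `−1`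
of every `S ∈ C_3`.  Hence **`0 ≤ J_3(G)` for every rank-`q` set `G` of a simple matroid with `4 ≤ q` and
`|G| = q + 4`**, every `q`.  Imports `Night2T3Corank` only.
-/
namespace PercRepro.Star

open Finset ThmH SixFour GenQ

variable {α : Type*} [DecidableEq α] {M : Matroid α} [M.Finite]

/-- For a point `x ∈ G`, the sets `S ∈ R_q(G)` with `|G ∖ S| = j + 1` avoiding `x` inject into the sets `S′ ∈ R_q(G)`
with `|G ∖ S′| = j` containing `x`, by `S ↦ S ∪ x` (`G` of rank `q`). -/
theorem card_filter_succ_notMem_le {G : Finset α} {q : ℕ} (hrG : M.eRk (G : Set α) = (q : ℕ∞)) {x : α}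
    (hxG : x ∈ G) (j : ℕ) :
    ((Rq M G q).filter (fun S : Finset α => (G \ S).card = j + 1 ∧ x ∉ S)).card ≤
      ((Rq M G q).filter (fun S : Finset α => (G \ S).card = j ∧ x ∈ S)).card := by
  apply Finset.card_le_card_of_injOn (fun S => insert x S)
  · intro S hS
    rw [Finset.mem_coe, Finset.mem_filter, mem_Rq] at hS ⊢
    have hsub : insert x S ⊆ G := Finset.insert_subset hxG hS.1.1
    have hr : M.eRk ((insert x S : Finset α) : Set α) = (q : ℕ∞) := by
      apply le_antisymm
      · rw [← hrG]
        exact M.eRk_mono (Finset.coe_subset.2 hsub)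
      · rw [← hS.1.2]
        exact M.eRk_mono (Finset.coe_subset.2 (Finset.subset_insert x S))
    refine ⟨⟨hsub, hr⟩, ?_, Finset.mem_insert_self x S⟩
    have h1 : G \ S = insert x (G \ insert x S) := by
      ext y
      simp only [Finset.mem_sdiff, Finset.mem_insert]
      constructor
      · rintro ⟨hyG, hyS⟩
        by_cases hyx : y = x
        · exact Or.inl hyx
        · exact Or.inr ⟨hyG, fun h => h.elim (fun h' => hyx h') hyS⟩
      · rintro (rfl | ⟨hyG, hy⟩)
        · exact ⟨hxG, hS.2.2⟩
        · exact ⟨hyG, fun h => hy (Or.inr h)⟩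
    have h2 : x ∉ G \ insert x S := by
      simp only [Finset.mem_sdiff, Finset.mem_insert, true_or, not_true_eq_false, and_false,
        not_false_eq_true]
    have h3 := Finset.card_insert_of_notMem h2
    rw [← h1, hS.2.1] at h3
    show (G \ insert x S).card = j
    omega
  · intro S hS S' hS' h
    simp only [Finset.mem_coe, Finset.mem_filter] at hS hS'
    have h' : insert x S = insert x S' := h
    have e1 : (insert x S).erase x = S := Finset.erase_insert hS.2.2
    have e2 : (insert x S').erase x = S' := Finset.erase_insert hS'.2.2
    rw [← e1, ← e2, h']

/-- **The up-degree bound**: `(j + 1)·#C_{j+1} ≤ (|G| − j)·#C_j` on a rank-`q` set `G`, where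
`C_j = {S ∈ R_q(G) : |G ∖ S| = j}`. -/
theorem succ_mul_card_le {G : Finset α} {q : ℕ} (hrG : M.eRk (G : Set α) = (q : ℕ∞)) (j : ℕ) :
    (j + 1) * ((Rq M G q).filter (fun S : Finset α => (G \ S).card = j + 1)).card ≤
      (G.card - j) * ((Rq M G q).filter (fun S : Finset α => (G \ S).card = j)).card := by
  -- left side: Σ_{S ∈ C_{j+1}} |G ∖ S| = Σ_{x ∈ G} #{S ∈ C_{j+1} : x ∉ S}
  have hL : (j + 1) * ((Rq M G q).filter (fun S : Finset α => (G \ S).card = j + 1)).card =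
      ∑ x ∈ G, ((Rq M G q).filter (fun S : Finset α => (G \ S).card = j + 1 ∧ x ∉ S)).card := by
    have h1 : ∀ S ∈ (Rq M G q).filter (fun S : Finset α => (G \ S).card = j + 1),
        (j + 1) = ∑ x ∈ G, (if x ∉ S then 1 else 0) := by
      intro S hS
      rw [Finset.mem_filter] at hS
      rw [Finset.sum_boole, ← Finset.sdiff_eq_filter, hS.2]
      simp
    calc (j + 1) * ((Rq M G q).filter (fun S : Finset α => (G \ S).card = j + 1)).card
        = ∑ S ∈ (Rq M G q).filter (fun S : Finset α => (G \ S).card = j + 1), (j + 1) := by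
          rw [Finset.sum_const, smul_eq_mul, mul_comm]
      _ = ∑ S ∈ (Rq M G q).filter (fun S : Finset α => (G \ S).card = j + 1),
            ∑ x ∈ G, (if x ∉ S then 1 else 0) := Finset.sum_congr rfl h1
      _ = ∑ x ∈ G, ∑ S ∈ (Rq M G q).filter (fun S : Finset α => (G \ S).card = j + 1),
            (if x ∉ S then 1 else 0) := Finset.sum_comm
      _ = ∑ x ∈ G, ((Rq M G q).filter (fun S : Finset α => (G \ S).card = j + 1 ∧ x ∉ S)).card := by
          apply Finset.sum_congr rfl
          intro x _
          rw [Finset.sum_boole, Finset.filter_filter]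
          simp
  have hR : (G.card - j) * ((Rq M G q).filter (fun S : Finset α => (G \ S).card = j)).card =
      ∑ x ∈ G, ((Rq M G q).filter (fun S : Finset α => (G \ S).card = j ∧ x ∈ S)).card := by
    have h1 : ∀ S ∈ (Rq M G q).filter (fun S : Finset α => (G \ S).card = j),
        (G.card - j) = ∑ x ∈ G, (if x ∈ S then 1 else 0) := by
      intro S hS
      rw [Finset.mem_filter] at hS
      have hsub : S ⊆ G := (mem_Rq.1 hS.1).1
      rw [Finset.sum_boole, Finset.filter_mem_eq_inter, Finset.inter_eq_right.2 hsub]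
      have := Finset.card_sdiff_of_subset hsub
      rw [hS.2] at this
      have hle := Finset.card_le_card hsub
      simp only [Nat.cast_id]
      omega
    calc (G.card - j) * ((Rq M G q).filter (fun S : Finset α => (G \ S).card = j)).card
        = ∑ S ∈ (Rq M G q).filter (fun S : Finset α => (G \ S).card = j), (G.card - j) := by
          rw [Finset.sum_const, smul_eq_mul, mul_comm]
      _ = ∑ S ∈ (Rq M G q).filter (fun S : Finset α => (G \ S).card = j),
            ∑ x ∈ G, (if x ∈ S then 1 else 0) := Finset.sum_congr rfl h1
      _ = ∑ x ∈ G, ∑ S ∈ (Rq M G q).filter (fun S : Finset α => (G \ S).card = j),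
            (if x ∈ S then 1 else 0) := Finset.sum_comm
      _ = ∑ x ∈ G, ((Rq M G q).filter (fun S : Finset α => (G \ S).card = j ∧ x ∈ S)).card := by
          apply Finset.sum_congr rfl
          intro x _
          rw [Finset.sum_boole, Finset.filter_filter]
          simp
  rw [hL, hR]
  apply Finset.sum_le_sum
  intro x hx
  exact card_filter_succ_notMem_le hrG hx j

/-- **The type-`3` balance at corank `4`**: on a simple matroid, `0 ≤ J_3(G)` for every rank-`q` set `G` with
`4 ≤ q` and `|G| = q + 4`. -/
theorem Jq_three_nonneg_of_card_eq_add_four (hs : Simple M) {G : Finset α} {q : ℕ} (hG : G ⊆ gr M)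
    (hrG : M.eRk (G : Set α) = (q : ℕ∞)) (hq : 4 ≤ q) (hcard : G.card = q + 4) : 0 ≤ Jq M G q 3 := by
  apply Jq_three_nonneg_of_sizes hs hG hrG (by omega)
  set C : ℕ → Finset (Finset α) := fun j => (Rq M G q).filter (fun S : Finset α => (G \ S).card = j) with hC
  -- the complement of a rank-`q` subset has at most `4` points
  have hj4 : ∀ S ∈ Rq M G q, (G \ S).card ≤ 4 := by
    intro S hS
    have hS' := mem_Rq.1 hS
    have hSq : q ≤ S.card := le_card_of_eRk_eq hS'.2
    rw [Finset.card_sdiff_of_subset hS'.1]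
    omega
  -- the sum over `R_q(G)` of the size terms, by the value of `|G ∖ S|`
  have hterm : ∀ S ∈ Rq M G q,
      ((G.card : ℚ) + (q : ℚ) - 3 - 2 * (S.card : ℚ)) = 2 * ((G \ S).card : ℚ) - 7 := by
    intro S hS
    have hS' := mem_Rq.1 hS
    have hsd := Finset.card_sdiff_of_subset hS'.1
    have hle := Finset.card_le_card hS'.1
    have : ((G \ S).card : ℚ) = (G.card : ℚ) - (S.card : ℚ) := by
      rw [hsd]
      push_cast [hle]
      ring
    rw [this, hcard]
    push_cast
    ring
  rw [Finset.sum_congr rfl hterm]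
  -- demand-free lower bound: `#C_0 + #C_1 + #C_2 ≤ DF_3`
  have hDF : ((C 0).card : ℚ) + ((C 1).card : ℚ) + ((C 2).card : ℚ) ≤ (DFq M G q 3 : ℚ) := by
    have h01 : Disjoint (C 0) (C 1) := by
      rw [Finset.disjoint_filter]
      intro S _ h0 h1
      omega
    have h012 : Disjoint (C 0 ∪ C 1) (C 2) := by
      rw [Finset.disjoint_union_left]
      constructor <;> (rw [Finset.disjoint_filter]; intro S _ h0 h1; omega)
    have hsub : C 0 ∪ C 1 ∪ C 2 ⊆ (Rq M G q).filter (fun S : Finset α => (G \ S).card ≤ 2) := by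
      intro S hS
      simp only [hC, Finset.mem_union, Finset.mem_filter] at hS ⊢
      rcases hS with (⟨h, h'⟩ | ⟨h, h'⟩) | ⟨h, h'⟩ <;> exact ⟨h, by omega⟩
    have hcardU := Finset.card_le_card hsub
    rw [Finset.card_union_of_disjoint h012, Finset.card_union_of_disjoint h01] at hcardU
    have := card_filter_sdiff_le_two_le_DFq (M := M) (G := G) (q := q)
    exact_mod_cast hcardU.trans this
  -- the sum splits over `j = 0, …, 4`
  have hsplit : ∑ S ∈ Rq M G q, (2 * ((G \ S).card : ℚ) - 7) =
      ∑ j ∈ Finset.range 5, ((C j).card : ℚ) * (2 * (j : ℚ) - 7) := by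
    rw [← Finset.sum_fiberwise_of_maps_to (s := Rq M G q) (t := Finset.range 5)
      (g := fun S : Finset α => (G \ S).card) (fun S hS => Finset.mem_range.2 (by have := hj4 S hS; omega))]
    apply Finset.sum_congr rfl
    intro j _
    rw [Finset.sum_congr rfl (fun S hS => by
      rw [(Finset.mem_filter.1 hS).2]), Finset.sum_const, nsmul_eq_mul]
  rw [hsplit, Finset.sum_range_succ, Finset.sum_range_succ, Finset.sum_range_succ,
    Finset.sum_range_succ, Finset.sum_range_one]
  -- the up-degree bound at `j = 2`: `3·#C_3 ≤ (q + 2)·#C_2`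
  have hup := succ_mul_card_le (M := M) hrG 2
  have hup' : (3 : ℚ) * ((C 3).card : ℚ) ≤ ((q : ℚ) + 2) * ((C 2).card : ℚ) := by
    have h := hup
    rw [hcard] at h
    have h' : (3 : ℕ) * (C 3).card ≤ (q + 2) * (C 2).card := by
      simpa [hC, show q + 4 - 2 = q + 2 by omega] using h
    exact_mod_cast h'
  -- `#C_0 = 1`: the only rank-`q` subset with empty complement is `G`
  have hC0 : (C 0).card = 1 := by
    have : C 0 = {G} := by
      ext S
      simp only [hC, Finset.mem_filter, mem_Rq, Finset.mem_singleton, Finset.card_eq_zero,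
        Finset.sdiff_eq_empty_iff_subset]
      constructor
      · rintro ⟨⟨hSG, -⟩, hGS⟩
        exact Finset.Subset.antisymm hSG hGS
      · rintro rfl
        exact ⟨⟨Finset.Subset.refl _, hrG⟩, Finset.Subset.refl _⟩
    rw [this, Finset.card_singleton]
  -- `#C_1 ≥ 4`: every point of `G` off its coloops gives a member, and at most `q` points are coloops of `M|G`
  have hC1 : 4 ≤ ((C 1).card : ℚ) := by
    have hm : mTr M G ≤ q := mTr_le_of_eRk_eq hG hrG
    have hcard1 : (G.filter (fun x => M.eRk ((G.erase x : Finset α) : Set α) = (q : ℕ∞))).card =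
        G.card - mTr M G := card_filter_eRk_erase_eq hG hrG
    have hinj : (G.filter (fun x => M.eRk ((G.erase x : Finset α) : Set α) = (q : ℕ∞))).card ≤
        (C 1).card := by
      apply Finset.card_le_card_of_injOn (fun x => G.erase x)
      · intro x hx
        rw [Finset.mem_coe, Finset.mem_filter] at hx
        simp only [hC, Finset.mem_coe, Finset.mem_filter, mem_Rq]
        refine ⟨⟨Finset.erase_subset x G, hx.2⟩, ?_⟩
        rw [Finset.sdiff_erase_self hx.1, Finset.card_singleton]
      · intro x hx y hy hxy
        simp only [Finset.mem_coe, Finset.mem_filter] at hx hy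
        have hxy' : G.erase x = G.erase y := hxy
        by_contra hne
        have : x ∈ G.erase y := Finset.mem_erase.2 ⟨hne, hx.1⟩
        rw [← hxy'] at this
        exact (Finset.notMem_erase x G) this
    have : 4 ≤ (C 1).card := by
      have := hcard1 ▸ hinj
      omega
    exact_mod_cast this
  have hq' : (4 : ℚ) ≤ (q : ℚ) := by exact_mod_cast hq
  have hC0' : ((C 0).card : ℚ) = 1 := by exact_mod_cast hC0
  have hC2' : (0 : ℚ) ≤ ((C 2).card : ℚ) := by positivity
  have hC4' : (0 : ℚ) ≤ ((C 4).card : ℚ) := by positivity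
  have hq2 : (0 : ℚ) ≤ (q : ℚ) + 2 := by positivity
  have e1 := mul_le_mul_of_nonneg_left hDF hq2
  have e3 : 4 * ((C 1).card : ℚ) ≤ (q : ℚ) * ((C 1).card : ℚ) :=
    mul_le_mul_of_nonneg_right hq' (by positivity)
  have e4 : 4 * ((C 2).card : ℚ) ≤ (q : ℚ) * ((C 2).card : ℚ) :=
    mul_le_mul_of_nonneg_right hq' hC2'
  push_cast
  nlinarith [e1, e3, e4, hup', hC1, hC0', hC2', hC4']

end PercRepro.Star
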